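import Summits.QuantumFields.BalabanUV.Beta.GAN24.ScalarSup110GPieces

/-!
# Row G-an2-4 ∕ (CONV-C), scalar currency — THE END OF THE LINE (L0) = (s0) = (K₀ˢ): the ZEROTH-ORDER, `n`-UNIFORM, VOLUME-UNIFORM
# `ℓ^∞` BLOCK BOUND WITH EXPONENTIAL DECAY FOR NE2's LITERAL SCALAR AVERAGED PROPAGATOR `G′ = Gps n M a′ = (Δ + a′Π′)⁻¹`,
# every `a′ > 0`, every `n ≥ 1`, every torus

NOT IN PRINT; OUR PROOF.  Cell `pub-balaban`, G-an2-4 crux team (coordinator ruling e34b3e0c (2)), seat `b2b-balaban-gan24-formalise-leaf-01`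
(gen 55).  INTERFACE REQUEST of record: `HOME/INBOX.md` l.4418 (road-P2 crux prover `b2b-balaban-gan24-p2` gen 29) «(L0) = (s0):
`∃ δ C > 0, ∀ n N₀ ≥ 1, y y′ r, Σ_{r′} ‖Gps n (fun _ => N₀) a′ (bpt n _ y r) (bpt n _ y′ r′)‖ ≤ C·e^{−δ·torusSupNorm (y − y′)}` (per-block
row sums, n-uniform)» — the common input of the scalar letters (L1)–(L4) (`…-leaf-06`'s `ScalarFlatResolvent.scalar_resolventStep_of_uniform`
takes EXACTLY the `hrow` proved here) and of `…-leaf-04`'s `ScalarSupReductions`.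

THE ROUTE (journal `CLAIMS.log` l.28990 ∕ l.29155).  With `F = (Δ + 1)⁻¹`, `P = Σ_{k<D} F^{k+1}`, `D = d + 1`, module 1's identity
`G′ = P − a′·P·Π′·G′ + F^D·G′` (`ScalarFreeResolvent.Gps_eq_resolvent_expansion`) splits `(G′J)(x)` for `supp J ⊆ B(y′)`, `|J| ≤ B` into
 (A) `(PJ)(x)`: module 2's `n`-uniform block rows of `P` (positivity + pv15's `cosh` supersolution);
 (B) `a′(P Π′ G′J)(x)`: THE POINT OF THE LINE — `Π′ = PiS` maps the BLOCK `ℓ²` norm to `ℓ^∞` with the factor `n^{−D/2}` that the `ℓ²` bound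
     of `G′J` carries (`|B(y′)|^{1/2} = n^{D/2}`), so the tree's `ℓ²` Combes–Thomas bound `CTScalarGreen.opNorm_conjMat_Gps_le` (weight
     `ρ_c = n⁻¹|· − c|_{T_η,∞}` of module 4, `Λ = 1`) gives `|(Π′G′J)(z)| ≤ γw⁻¹e^{2κ}e^{−κ|blk z − y′|}B` with NO loss in `n`; then module 2 again;
 (C) `(F^D G′J)(x)`: Cauchy–Schwarz against the weighted `ℓ²` norm of `G′J`, module 3's diagonal bound `|F^D(x,z)| ≤ 3^D n^{−D}` paying for
     `‖J‖₂² ≤ n^D B²`, and module 2's rows of `F^D` with slope `2κ/n`.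
Constants: `γ′ = gammaPs (d+1) a′`, `κ = γ′/(16D(2D + a′))` (so `Jfree D a′ κ 1 ≤ γ′/2`, `λ_{κ/n}, λ_{2κ/n} ≥ 1/2` for every `n`), `γw = γ′ − Jfree`.

WHAT IS PROVED (kernel; any `d`, any `a′ > 0`; then every `n ≥ 1`, every torus `M : Fin (d+1) → ℕ`):
 * (module 5 `ScalarSup110GPieces`: the terms (B1), (B), (C));
 * §1 constants: `kappa_pos`, `jfree_kappa_lt`, `lam_kappa_ge_half`, `lam_two_kappa_ge_half`;
 * §2 THE END: **`norm_Gps_mulVec_bpt_le`** (operator form: `supp J ⊆ B(y′)`, `|J| ≤ B` ⟹ `‖(G′J)(n·y + r)‖ ≤ C·e^{−δ₀|y − y′|_{T₁,∞}}·B`) and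
   **`gps_block_row_sum_le`**: `∃ δ₀ C > 0, ∀ n [NeZero n] M [∀ μ, NeZero (M μ)] y y′ r, Σ_{r′} ‖Gps n M a′ (bpt n M (toT M y) r) (bpt n M (toT M y′) r′)‖
   ≤ C·exp(−δ₀·torusSupNorm M (y − y′))`.

HONEST SCOPE.  [folklore]-grade lattice analysis of the cell's typed `U = 1` objects, OUR proof and OUR (crude) constants; Bałaban prints (1.110)
for the VECTOR `G` ([B5] `Balaban1984PropagatorsI` p. 35) — the scalar block bound is [B9] (3.42)-type folklore, located, not quoted, not used.
No `def`, no `def … : Prop`, no `sorry`.  NOT (CONV-C), NEVER «G-an2-4 closed», NOT NE2 ∕ NE3, NOT D1, NOT BetaPertH, NOT the continuum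
limit, NOT Clay.  HONEST DEPENDENCY: continuum YM on T⁴ ⇐ BetaPertH ∧ nine spine estimates (0/9 proved); BetaPertH ⇐ (D1) ∧ (D4) ∧ CAP+tail;
G-an2-4 gates asym, D1 and NE2/3/4.
-/

noncomputable section

open scoped BigOperators ComplexConjugate Matrix Matrix.Norms.L2Operator
open Finset Complex Matrix

namespace Summit.QuantumFields.BalabanUV.Beta.GAN24.ScalarSup110G

open Literature.MathematicalPhysics.QuantumFieldTheory.Balaban1983to89
open B5Prop11Plancherel (Tor fine)
open B5Prop11Lower (nsq nsq_nonneg nsq_mulVec_le)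
open B5Action121 (LapS)
open B5Block118 (bpt)
open B5Blocks16 (blockOf blockOf_bpt)
open B6LowerBound2153Torus (toT rep toT_rep)
open B4TorusKernel.MultiPeriod (circAbs torusSupNorm torusSupNorm_nonneg)
open B6Cov2156Torus (one_le_M)
open B5G115SupBound (exists_eq_bpt_blockOf)
open Beta.DeltaACombesThomas (sq_mul_cosh_div_sub_one_le)
open Summit.QuantumFields.BalabanUV.T4Continuum
open Summit.QuantumFields.BalabanUV.T4Continuum.ScalarBlockPoincare (PiS)
open Summit.QuantumFields.BalabanUV.T4Continuum.ScalarAveragedPropagator (Gps gammaPs gammaPs_pos)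
open Summit.QuantumFields.BalabanUV.T4Continuum.ScalarCovariantCTWeighted (wvec)
open Summit.QuantumFields.BalabanUV.T4Continuum.CTWeightedCoercivity (conjMat wvec_mulVec)
open Summit.QuantumFields.BalabanUV.T4Continuum.ScalarCovariantCTDefects (PiS_apply sum_ite_blockOf_eq)
open Summit.QuantumFields.BalabanUV.T4Continuum.CTScalarGreen (Jfree Jfree_nonneg opNorm_conjMat_Gps_le)
open Summit.QuantumFields.BalabanUV.Beta.GAN24.ScalarFreeResolvent
open Summit.QuantumFields.BalabanUV.Beta.GAN24.ScalarFreeResolventRows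
open Summit.QuantumFields.BalabanUV.Beta.GAN24.ScalarFreeResolventDiagonal
open Summit.QuantumFields.BalabanUV.Beta.GAN24.ScalarSup110GWeight

open Summit.QuantumFields.BalabanUV.Beta.GAN24.ScalarSup110GPieces

variable {d : ℕ}

/-! ## §1 The constants of the line -/

section Constants

/-- `n²(cosh(t/n) − 1) ≤ (3/2)·t²` for `t² ≤ 2` (`≤ (t²/2)e^{t²/2}`, `DeltaACombesThomas.sq_mul_cosh_div_sub_one_le`, and `e ≤ 3`). [folklore] -/
theorem sq_mul_cosh_div_sub_one_le' (n : ℕ) (hn : 1 ≤ n) {t : ℝ} (ht : t ^ 2 ≤ 2) :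
    (n : ℝ) ^ 2 * (Real.cosh (t / n) - 1) ≤ 3 / 2 * t ^ 2 := by
  have h := sq_mul_cosh_div_sub_one_le n t hn
  have he : Real.exp (t ^ 2 / 2) ≤ 3 := by
    calc Real.exp (t ^ 2 / 2) ≤ Real.exp 1 := Real.exp_le_exp.mpr (by linarith)
      _ ≤ 3 := by have h9 := Real.exp_one_lt_d9; norm_num at h9; linarith
  calc (n : ℝ) ^ 2 * (Real.cosh (t / n) - 1) ≤ t ^ 2 / 2 * Real.exp (t ^ 2 / 2) := h
    _ ≤ t ^ 2 / 2 * 3 := mul_le_mul_of_nonneg_left he (by positivity)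
    _ = 3 / 2 * t ^ 2 := by ring

/-- **`λ_{t/n} ≥ 1/2` uniformly in `n`**: `t² ≤ 1/(6(d+1))` ⟹ `1 − 2(d+1)n²(cosh(t/n) − 1) ≥ 1/2` for every `n ≥ 1`. [folklore] -/
theorem lam_ge_half {t : ℝ} (ht : t ^ 2 ≤ 1 / (6 * ((d : ℝ) + 1))) (n : ℕ) [NeZero n] :
    1 / 2 ≤ 1 - 2 * (d + 1) * (n : ℝ) ^ 2 * (Real.cosh (t / n) - 1) := by
  have hd : (0 : ℝ) < 6 * ((d : ℝ) + 1) := by positivity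
  have hd1 : (1 : ℝ) ≤ 6 * ((d : ℝ) + 1) := by linarith [(Nat.cast_nonneg d : (0 : ℝ) ≤ d)]
  have ht2 : t ^ 2 ≤ 2 := ht.trans (((div_le_one hd).mpr hd1).trans (by norm_num))
  have h := sq_mul_cosh_div_sub_one_le' n (Nat.one_le_iff_ne_zero.mpr (NeZero.ne n)) ht2
  have h2 : 3 * ((d : ℝ) + 1) * t ^ 2 ≤ 1 / 2 := by
    rw [le_div_iff₀ hd] at ht
    linarith
  have h3 : 2 * (d + 1) * ((n : ℝ) ^ 2 * (Real.cosh (t / n) - 1)) ≤ 2 * (d + 1) * (3 / 2 * t ^ 2) :=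
    mul_le_mul_of_nonneg_left h (by positivity)
  linarith

variable (d : ℕ) {a' : ℝ}

/-- the rate of the line `κ = γ′/(16(d+1)(2(d+1) + a′))` is positive and `≤ 1/(16(d+1))`. [folklore] -/
theorem kappa_pos_le (ha' : 0 < a') :
    0 < gammaPs (d + 1) a' / (16 * ((d : ℝ) + 1) * (2 * ((d : ℝ) + 1) + a'))
      ∧ gammaPs (d + 1) a' / (16 * ((d : ℝ) + 1) * (2 * ((d : ℝ) + 1) + a')) ≤ 1 / (16 * ((d : ℝ) + 1)) := by
  obtain ⟨hγ0, hγ1⟩ := gammaPs_pos (d := d + 1) (a' := a')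
  have hD : (0 : ℝ) < (d : ℝ) + 1 := by positivity
  refine ⟨by positivity, ?_⟩
  rw [div_le_div_iff₀ (by positivity) (by positivity)]
  nlinarith

/-- **the free row-defect budget at the rate of the line is below coercivity**: `Jfree (d+1) a′ κ 1 < γ′` (indeed `≤ 3γ′κ/(16(d+1))`).
[folklore] -/
theorem jfree_kappa_lt (ha' : 0 < a') :
    Jfree (d + 1) a' (gammaPs (d + 1) a' / (16 * ((d : ℝ) + 1) * (2 * ((d : ℝ) + 1) + a'))) 1 < gammaPs (d + 1) a' := by
  obtain ⟨hγ0, hγ1⟩ := gammaPs_pos (d := d + 1) (a' := a')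
  obtain ⟨hκ0, hκ1⟩ := kappa_pos_le d ha'
  set κ := gammaPs (d + 1) a' / (16 * ((d : ℝ) + 1) * (2 * ((d : ℝ) + 1) + a')) with hκ
  have hD : (0 : ℝ) < (d : ℝ) + 1 := by positivity
  have hκ16 : κ ≤ 1 / 16 := hκ1.trans (by rw [div_le_div_iff₀ (by positivity) (by norm_num)]; nlinarith)
  have hκsq : κ ^ 2 ≤ 2 := by nlinarith
  -- `e^{κ²/2} ≤ 3`, `cosh κ − 1 ≤ (3/2)κ²`
  have he : Real.exp (κ ^ 2 / 2) ≤ 3 := by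
    calc Real.exp (κ ^ 2 / 2) ≤ Real.exp 1 := Real.exp_le_exp.mpr (by linarith)
      _ ≤ 3 := by have h9 := Real.exp_one_lt_d9; norm_num at h9; linarith
  have hcosh : Real.cosh (κ * 1) - 1 ≤ 3 / 2 * κ ^ 2 := by
    have h := sq_mul_cosh_div_sub_one_le' 1 le_rfl hκsq
    simp only [Nat.cast_one, one_pow, one_mul, div_one] at h
    rw [mul_one]; exact h
  -- `κ·(2(d+1) + a′) = γ′/(16(d+1))`
  have hprod : κ * (2 * ((d : ℝ) + 1) + a') = gammaPs (d + 1) a' / (16 * ((d : ℝ) + 1)) := by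
    rw [hκ]; field_simp
  unfold Jfree
  push_cast
  have h1 : ((d : ℝ) + 1) * κ ^ 2 * Real.exp (κ ^ 2 / 2) ≤ ((d : ℝ) + 1) * κ ^ 2 * 3 :=
    mul_le_mul_of_nonneg_left he (by positivity)
  have h2 : a' * (Real.cosh (κ * 1) - 1) ≤ a' * (3 / 2 * κ ^ 2) := mul_le_mul_of_nonneg_left hcosh ha'.le
  -- `3(d+1)κ² + (3/2)a′κ² ≤ 3κ·κ(2(d+1)+a′) = 3κγ′/(16(d+1)) ≤ 3γ′/256 < γ′`
  have h3 : ((d : ℝ) + 1) * κ ^ 2 * 3 + a' * (3 / 2 * κ ^ 2) ≤ 3 * κ * (κ * (2 * ((d : ℝ) + 1) + a')) := by nlinarith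
  rw [hprod] at h3
  have h4 : 3 * κ * (gammaPs (d + 1) a' / (16 * ((d : ℝ) + 1))) ≤ 3 * (1 / 16) * (gammaPs (d + 1) a' / (16 * ((d : ℝ) + 1))) :=
    mul_le_mul_of_nonneg_right (by linarith) (by positivity)
  have h5 : gammaPs (d + 1) a' / (16 * ((d : ℝ) + 1)) ≤ gammaPs (d + 1) a' := by
    rw [div_le_iff₀ (by positivity)]; nlinarith
  linarith

/-- both supersolution constants of the line are `≥ 1/2`, uniformly in `n`: `t = κ` and `t = 2κ`. [folklore] -/
theorem lam_kappa_ge_half (ha' : 0 < a') (n : ℕ) [NeZero n] :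
    1 / 2 ≤ 1 - 2 * (d + 1) * (n : ℝ) ^ 2
        * (Real.cosh (gammaPs (d + 1) a' / (16 * ((d : ℝ) + 1) * (2 * ((d : ℝ) + 1) + a')) / n) - 1)
      ∧ 1 / 2 ≤ 1 - 2 * (d + 1) * (n : ℝ) ^ 2
        * (Real.cosh (2 * (gammaPs (d + 1) a' / (16 * ((d : ℝ) + 1) * (2 * ((d : ℝ) + 1) + a'))) / n) - 1) := by
  obtain ⟨hκ0, hκ1⟩ := kappa_pos_le d ha'
  set κ := gammaPs (d + 1) a' / (16 * ((d : ℝ) + 1) * (2 * ((d : ℝ) + 1) + a')) with hκ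
  have hD : (0 : ℝ) < (d : ℝ) + 1 := by positivity
  have hD1 : (1 : ℝ) ≤ (d : ℝ) + 1 := by linarith [(Nat.cast_nonneg d : (0 : ℝ) ≤ d)]
  -- `(2κ)² ≤ (1/(8(d+1)))² ≤ 1/(6(d+1))`
  have hk2 : (2 * κ) ^ 2 ≤ 1 / (6 * ((d : ℝ) + 1)) := by
    have h1 : 2 * κ ≤ 1 / (8 * ((d : ℝ) + 1)) := by
      calc 2 * κ ≤ 2 * (1 / (16 * ((d : ℝ) + 1))) := by linarith
        _ = 1 / (8 * ((d : ℝ) + 1)) := by field_simp; ring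
    have h2 : (2 * κ) ^ 2 ≤ (1 / (8 * ((d : ℝ) + 1))) ^ 2 := pow_le_pow_left₀ (by linarith) h1 2
    refine h2.trans ?_
    rw [div_pow, one_pow, div_le_div_iff₀ (by positivity) (by positivity)]
    nlinarith
  have hk1 : κ ^ 2 ≤ 1 / (6 * ((d : ℝ) + 1)) := le_trans (by nlinarith) hk2
  exact ⟨lam_ge_half hk1 n, lam_ge_half hk2 n⟩

end Constants

/-! ## §2 The END of the line -/

section End

/-- **(L0) = (s0) = (K₀ˢ), OPERATOR FORM.**  For every `d` and every `a′ > 0` there are `δ₀, C > 0` (functions of `d, a′` only) such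
that for every `n ≥ 1`, every torus `M : Fin (d+1) → ℕ`, every pair of unit blocks `B(y), B(y′)` and every source `J` supported in
`B(y′)` with `|J| ≤ B`:  `‖(G′J)(n·y + r)‖ ≤ C·e^{−δ₀|y − y′|_{T₁,∞}}·B`, `G′ = Gps n M a′ = (LapS + a′•PiS)⁻¹` (NE2's literal scalar
averaged propagator).  The scalar, every-`a′`, every-torus twin of pv15's `B5Prop12Entries110.entry110G_one`; location of the analogous
printed VECTOR statement: [B5] `Balaban1984PropagatorsI` p. 35 (1.110), first entry — not used, not quoted. [folklore] -/
theorem norm_Gps_mulVec_bpt_le (d : ℕ) {a' : ℝ} (ha' : 0 < a') :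
    ∃ δ₀ C : ℝ, 0 < δ₀ ∧ 0 < C ∧ ∀ (n : ℕ) [NeZero n] (M : Fin (d + 1) → ℕ) [∀ μ, NeZero (M μ)]
      (y y' : Fin (d + 1) → ℤ) (J : Tor (fine n M) → ℂ) (B : ℝ), (∀ z, ‖J z‖ ≤ B) →
      (∀ z, J z ≠ 0 → ∃ r' : Fin (d + 1) → Fin n, z = bpt n M (toT M y') r') →
      ∀ r : Fin (d + 1) → Fin n,
        ‖(Gps n M a' *ᵥ J) (bpt n M (toT M y) r)‖ ≤ C * Real.exp (-(δ₀ * torusSupNorm M (y - y'))) * B := by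
  obtain ⟨hκ0, hκ1⟩ := kappa_pos_le d ha'
  have hJf := jfree_kappa_lt d ha'
  set κ := gammaPs (d + 1) a' / (16 * ((d : ℝ) + 1) * (2 * ((d : ℝ) + 1) + a')) with hκ
  set γw := gammaPs (d + 1) a' - Jfree (d + 1) a' κ 1 with hγw
  have hγw0 : 0 < γw := by rw [hγw]; linarith
  -- the constants of the three terms (with `λ⁻¹ ≤ 2`, `e^{κ(n−1)/n} ≤ e^κ`)
  set CA : ℝ := 2 * (((d : ℝ) + 1) * 2 ^ (d + 1)) * Real.exp κ with hCA
  set CB : ℝ := a' * (2 * (((d : ℝ) + 1) * 2 ^ (d + 1)) * Real.exp κ * (γw⁻¹ * Real.exp κ ^ 2)) with hCB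
  set CC : ℝ := 2 * 3 ^ (d + 1) * 2 ^ (d + 1) * Real.exp κ ^ 2 * (γw⁻¹ * Real.exp κ ^ 2) with hCC
  have hCA0 : 0 < CA := by rw [hCA]; positivity
  have hCB0 : 0 < CB := by rw [hCB]; positivity
  have hCC0 : 0 < CC := by rw [hCC]; positivity
  refine ⟨κ, CA + CB + CC, hκ0, by positivity, ?_⟩
  intro n _ M _ y y' J B hJB hsupp r
  have hn : (0 : ℝ) < n := by exact_mod_cast Nat.pos_of_ne_zero (NeZero.ne n)
  have hn1 : 1 ≤ n := Nat.one_le_iff_ne_zero.mpr (NeZero.ne n)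
  set x := bpt n M (toT M y) r with hx
  set T := torusSupNorm M (y - y') with hT
  set E := Real.exp (-(κ * T)) with hE
  have hB0 : 0 ≤ B := (norm_nonneg _).trans (hJB x)
  have hE0 : 0 < E := Real.exp_pos _
  -- the two supersolution constants
  obtain ⟨hl1, hl2⟩ := lam_kappa_ge_half d ha' n
  set lam1 := 1 - 2 * (d + 1) * (n : ℝ) ^ 2 * (Real.cosh (κ / n) - 1) with hlam1
  set lam2 := 1 - 2 * (d + 1) * (n : ℝ) ^ 2 * (Real.cosh (2 * κ / n) - 1) with hlam2
  have hl1' : 0 < lam1 := by linarith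
  have hl2' : 0 < lam2 := by linarith
  have hinv1 : lam1⁻¹ ^ (d + 1) ≤ 2 ^ (d + 1) :=
    pow_le_pow_left₀ (inv_nonneg.mpr hl1'.le) (by rw [inv_le_comm₀ hl1' (by norm_num)]; linarith) _
  have hinv2 : lam2⁻¹ ^ (d + 1) ≤ 2 ^ (d + 1) :=
    pow_le_pow_left₀ (inv_nonneg.mpr hl2'.le) (by rw [inv_le_comm₀ hl2' (by norm_num)]; linarith) _
  have hfrac : ((n : ℝ) - 1) / n ≤ 1 := by rw [div_le_one hn]; linarith
  have he1 : Real.exp (κ / n * ((n : ℝ) - 1)) ≤ Real.exp κ := by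
    rw [Real.exp_le_exp, div_mul_eq_mul_div, mul_div_assoc]
    exact mul_le_of_le_one_right hκ0.le hfrac
  have he2 : Real.exp (2 * κ / n * ((n : ℝ) - 1)) ≤ Real.exp κ ^ 2 := by
    rw [← Real.exp_nat_mul, Real.exp_le_exp, div_mul_eq_mul_div, mul_div_assoc]
    push_cast
    nlinarith [mul_le_of_le_one_right hκ0.le hfrac]
  -- the identity of the route
  set F := (LapS (fine n M) (n : ℂ) + 1)⁻¹ with hF
  set P := ∑ k ∈ Finset.range (d + 1), F ^ (k + 1) with hP
  have hid := Gps_eq_resolvent_expansion n M ha' (d + 1)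
  rw [← hF, ← hP] at hid
  have hsplit : (Gps n M a' *ᵥ J) x
      = (P *ᵥ J) x - (a' : ℂ) * (((P * PiS n M * Gps n M a') *ᵥ J) x) + ((F ^ (d + 1) * Gps n M a') *ᵥ J) x := by
    conv_lhs => rw [hid]
    rw [Matrix.add_mulVec, Matrix.sub_mulVec, Matrix.smul_mulVec]
    simp only [Pi.add_apply, Pi.sub_apply, Pi.smul_apply, smul_eq_mul]
  -- term A
  have hA : ‖(P *ᵥ J) x‖ ≤ CA * E * B := by
    have h1 := norm_mulVec_le_of_block_support n M P y' J hJB hsupp x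
    have h2 := resolventPoly_block_rowsum_le n hn1 M (a := κ / n) (div_nonneg hκ0.le hn.le) hl1' (d + 1) y y' r
    rw [div_mul_cancel₀ κ hn.ne'] at h2
    have h3 : 2 * (((d + 1 : ℕ) : ℝ) * lam1⁻¹ ^ (d + 1)) * Real.exp (κ / n * ((n : ℝ) - 1)) ≤ CA := by
      rw [hCA]; push_cast
      exact mul_le_mul (mul_le_mul_of_nonneg_left (mul_le_mul_of_nonneg_left hinv1 (by positivity)) (by norm_num)) he1
        (Real.exp_pos _).le (by positivity)
    calc ‖(P *ᵥ J) x‖ ≤ B * ∑ r' : Fin (d + 1) → Fin n, ‖P x (bpt n M (toT M y') r')‖ := h1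
      _ ≤ B * (2 * (((d + 1 : ℕ) : ℝ) * lam1⁻¹ ^ (d + 1)) * Real.exp (κ / n * ((n : ℝ) - 1)) * E) :=
          mul_le_mul_of_nonneg_left h2 hB0
      _ ≤ B * (CA * E) := mul_le_mul_of_nonneg_left (mul_le_mul_of_nonneg_right h3 hE0.le) hB0
      _ = CA * E * B := by ring
  -- term B
  have hB : ‖(a' : ℂ) * (((P * PiS n M * Gps n M a') *ᵥ J) x)‖ ≤ CB * E * B := by
    have h2 := termB_le n M ha' hκ0.le hJf hl1' (d + 1) y y' r J hJB hsupp
    rw [norm_mul, Complex.norm_real, Real.norm_of_nonneg ha'.le]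
    have h3 : 2 * (((d + 1 : ℕ) : ℝ) * lam1⁻¹ ^ (d + 1)) * Real.exp (κ / n * ((n : ℝ) - 1)) * (γw⁻¹ * Real.exp κ ^ 2 * B)
        ≤ 2 * (((d : ℝ) + 1) * 2 ^ (d + 1)) * Real.exp κ * (γw⁻¹ * Real.exp κ ^ 2) * B := by
      push_cast
      have h4 : 2 * (((d : ℝ) + 1) * lam1⁻¹ ^ (d + 1)) * Real.exp (κ / n * ((n : ℝ) - 1))
          ≤ 2 * (((d : ℝ) + 1) * 2 ^ (d + 1)) * Real.exp κ :=
        mul_le_mul (mul_le_mul_of_nonneg_left (mul_le_mul_of_nonneg_left hinv1 (by positivity)) (by norm_num)) he1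
          (Real.exp_pos _).le (by positivity)
      have h5 : 0 ≤ γw⁻¹ * Real.exp κ ^ 2 * B := by positivity
      calc 2 * (((d : ℝ) + 1) * lam1⁻¹ ^ (d + 1)) * Real.exp (κ / n * ((n : ℝ) - 1)) * (γw⁻¹ * Real.exp κ ^ 2 * B)
          ≤ 2 * (((d : ℝ) + 1) * 2 ^ (d + 1)) * Real.exp κ * (γw⁻¹ * Real.exp κ ^ 2 * B) := mul_le_mul_of_nonneg_right h4 h5
        _ = _ := by ring
    calc a' * ‖((P * PiS n M * Gps n M a') *ᵥ J) x‖
        ≤ a' * (2 * (((d + 1 : ℕ) : ℝ) * lam1⁻¹ ^ (d + 1)) * Real.exp (κ / n * ((n : ℝ) - 1)) * (γw⁻¹ * Real.exp κ ^ 2 * B) * E) :=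
          mul_le_mul_of_nonneg_left h2 ha'.le
      _ ≤ a' * (2 * (((d : ℝ) + 1) * 2 ^ (d + 1)) * Real.exp κ * (γw⁻¹ * Real.exp κ ^ 2) * B * E) :=
          mul_le_mul_of_nonneg_left (mul_le_mul_of_nonneg_right h3 hE0.le) ha'.le
      _ = CB * E * B := by rw [hCB]; ring
  -- term C
  have hC : ‖((F ^ (d + 1) * Gps n M a') *ᵥ J) x‖ ≤ CC * E * B := by
    have h2 := termC_le n M ha' hκ0.le hJf hl2' (le_refl (d + 1)) y y' r J hJB hsupp
    have h3 : 2 * 3 ^ (d + 1) * lam2⁻¹ ^ (d + 1) * Real.exp (2 * κ / n * ((n : ℝ) - 1)) * (γw⁻¹ * Real.exp κ ^ 2 * B)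
        ≤ 2 * 3 ^ (d + 1) * 2 ^ (d + 1) * Real.exp κ ^ 2 * (γw⁻¹ * Real.exp κ ^ 2) * B := by
      have h4 : 2 * 3 ^ (d + 1) * lam2⁻¹ ^ (d + 1) * Real.exp (2 * κ / n * ((n : ℝ) - 1))
          ≤ 2 * 3 ^ (d + 1) * 2 ^ (d + 1) * Real.exp κ ^ 2 :=
        mul_le_mul (mul_le_mul_of_nonneg_left hinv2 (by positivity)) he2 (Real.exp_pos _).le (by positivity)
      have h5 : 0 ≤ γw⁻¹ * Real.exp κ ^ 2 * B := by positivity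
      calc 2 * 3 ^ (d + 1) * lam2⁻¹ ^ (d + 1) * Real.exp (2 * κ / n * ((n : ℝ) - 1)) * (γw⁻¹ * Real.exp κ ^ 2 * B)
          ≤ 2 * 3 ^ (d + 1) * 2 ^ (d + 1) * Real.exp κ ^ 2 * (γw⁻¹ * Real.exp κ ^ 2 * B) := mul_le_mul_of_nonneg_right h4 h5
        _ = _ := by ring
    calc ‖((F ^ (d + 1) * Gps n M a') *ᵥ J) x‖
        ≤ 2 * 3 ^ (d + 1) * lam2⁻¹ ^ (d + 1) * Real.exp (2 * κ / n * ((n : ℝ) - 1)) * (γw⁻¹ * Real.exp κ ^ 2 * B) * E := h2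
      _ ≤ 2 * 3 ^ (d + 1) * 2 ^ (d + 1) * Real.exp κ ^ 2 * (γw⁻¹ * Real.exp κ ^ 2) * B * E := mul_le_mul_of_nonneg_right h3 hE0.le
      _ = CC * E * B := by rw [hCC]; ring
  -- assembly
  rw [hsplit]
  calc ‖(P *ᵥ J) x - (a' : ℂ) * (((P * PiS n M * Gps n M a') *ᵥ J) x) + ((F ^ (d + 1) * Gps n M a') *ᵥ J) x‖
      ≤ ‖(P *ᵥ J) x‖ + ‖(a' : ℂ) * (((P * PiS n M * Gps n M a') *ᵥ J) x)‖ + ‖((F ^ (d + 1) * Gps n M a') *ᵥ J) x‖ :=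
        (norm_add_le _ _).trans (add_le_add (norm_sub_le _ _) le_rfl)
    _ ≤ CA * E * B + CB * E * B + CC * E * B := add_le_add (add_le_add hA hB) hC
    _ = (CA + CB + CC) * Real.exp (-(κ * torusSupNorm M (y - y'))) * B := by rw [hE, hT]; ring

/-- **(L0) = (s0) = (K₀ˢ), BLOCK-ROW FORM — THE INTERFACE REQUEST OF RECORD** (`HOME/INBOX.md` l.4418; the `hrow` of `…-leaf-06`'s
`ScalarFlatResolvent.scalar_resolventStep_of_uniform` and, after `exists_eq_bpt`, of `…-leaf-04`'s `ScalarSupReductions`): for every `d`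
and every `a′ > 0` there are `δ₀, C > 0` such that for every `n ≥ 1`, every torus and all blocks,
`Σ_{r′} ‖Gps n M a′ (n·x + r, n·x′ + r′)‖ ≤ C·e^{−δ₀|x − x′|_{T₁,∞}}`. [folklore] -/
theorem gps_block_row_sum_le (d : ℕ) {a' : ℝ} (ha' : 0 < a') :
    ∃ δ₀ C : ℝ, 0 < δ₀ ∧ 0 < C ∧ ∀ (n : ℕ) [NeZero n] (M : Fin (d + 1) → ℕ) [∀ μ, NeZero (M μ)]
      (x x' : Fin (d + 1) → ℤ) (r : Fin (d + 1) → Fin n),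
      ∑ r' : Fin (d + 1) → Fin n, ‖Gps n M a' (bpt n M (toT M x) r) (bpt n M (toT M x') r')‖
        ≤ C * Real.exp (-(δ₀ * torusSupNorm M (x - x'))) := by
  obtain ⟨δ₀, C, hδ, hC, h⟩ := norm_Gps_mulVec_bpt_le d ha'
  refine ⟨δ₀, C, hδ, hC, fun n _ M _ x x' r => ?_⟩
  set x₀ := bpt n M (toT M x) r with hx₀
  -- the phase test function of the block `B(x′)`
  set J : Tor (fine n M) → ℂ := fun z =>
    if blockOf n M z = toT M x' then star (Gps n M a' x₀ z) / ((‖Gps n M a' x₀ z‖ : ℝ) : ℂ) else 0 with hJ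
  have hJB : ∀ z, ‖J z‖ ≤ 1 := by
    intro z
    rw [hJ]; dsimp only
    split_ifs with hz
    · rw [norm_div, norm_star, Complex.norm_real, Real.norm_of_nonneg (norm_nonneg _)]
      exact div_self_le_one _
    · rw [norm_zero]; exact zero_le_one
  have hsupp : ∀ z, J z ≠ 0 → ∃ r' : Fin (d + 1) → Fin n, z = bpt n M (toT M x') r' := by
    intro z hz
    have hb : blockOf n M z = toT M x' := by
      by_contra hb
      exact hz (by rw [hJ]; dsimp only; rw [if_neg hb])
    obtain ⟨r', hr'⟩ := exists_eq_bpt_blockOf n M z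
    exact ⟨r', by rw [← hb]; exact hr'⟩
  -- `(G′J)(x₀) = Σ_{r′} ‖G′(x₀, n·x′ + r′)‖`
  have hterm : ∀ z, Gps n M a' x₀ z * J z = if blockOf n M z = toT M x' then (((‖Gps n M a' x₀ z‖ : ℝ)) : ℂ) else 0 := by
    intro z
    rw [hJ]; dsimp only
    split_ifs with hz
    · rw [mul_div_assoc', Complex.star_def, Complex.mul_conj, Complex.normSq_eq_norm_sq]
      by_cases h0 : ‖Gps n M a' x₀ z‖ = 0
      · rw [h0]; simp
      · push_cast
        rw [pow_two, mul_div_assoc, div_self (by exact_mod_cast h0), mul_one]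
    · rw [mul_zero]
  have hφ := bpt_toT_injective n M x'
  have hzero : ∀ z ∈ (Finset.univ : Finset (Tor (fine n M))),
      z ∉ Finset.univ.image (fun r' : Fin (d + 1) → Fin n => bpt n M (toT M x') r') →
        (if blockOf n M z = toT M x' then (((‖Gps n M a' x₀ z‖ : ℝ)) : ℂ) else 0) = 0 := by
    intro z _ hz
    by_cases hb : blockOf n M z = toT M x'
    · exfalso; apply hz
      obtain ⟨r', hr'⟩ := exists_eq_bpt_blockOf n M z
      exact Finset.mem_image.mpr ⟨r', Finset.mem_univ _, by rw [← hb]; exact hr'.symm⟩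
    · rw [if_neg hb]
  have hGJ : (Gps n M a' *ᵥ J) x₀ = (((∑ r' : Fin (d + 1) → Fin n, ‖Gps n M a' x₀ (bpt n M (toT M x') r')‖ : ℝ)) : ℂ) := by
    simp only [Matrix.mulVec, dotProduct]
    rw [Finset.sum_congr rfl fun z _ => hterm z, ← Finset.sum_subset (Finset.subset_univ _) hzero,
      Finset.sum_image fun p _ q _ h => hφ h]
    push_cast
    exact Finset.sum_congr rfl fun r' _ => by rw [blockOf_bpt, if_pos rfl]
  have h1 := h n M x x' J 1 hJB hsupp r
  rw [← hx₀, hGJ, Complex.norm_real, Real.norm_of_nonneg (Finset.sum_nonneg fun r' _ => norm_nonneg _), mul_one] at h1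
  exact h1

end End

end Summit.QuantumFields.BalabanUV.Beta.GAN24.ScalarSup110G

end
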